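import Summits.RiemannHypothesis.RiemannHypothesis.Theorems.Splittings.RobinFiniteStairLaw
import HarnessLib

/-!
# RobinFiniteStairRanges — g18 «THE WHOLE STAIRCASE», part 7/9

Rows I: `tailH` numerics (`exp_ge_num`, `log_div_two_pi_le_num`, `tailH_le_num`, `tailH_anti`, `charge_le`, `top_of_num`) and the rows `T ≥
10⁵ ⟹ robinCA_below 250000001`, `1.05·10⁵ ⟹ 4¹⁴`, `1.6·10⁵ ⟹ 850000001`, `1.8·10⁵ ⟹ 4¹⁵`, `3.3·10⁵ ⟹ 4000000001`, `3.4·10⁵ ⟹ 4¹⁶`.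

Cell rh-split, seat rh-split-robin-finite g18 (brief sha16 f79c5f09d8bcb036), card `cards/SPLIT-robin-finite.md` §25; carved VERBATIM from the
kernel-checked object `HOME/rh-split-robin-finite/g18/SketchG18.lean` (sha16 bca90f5376387c1c; `lean check` rc 0, 0 warnings, 0 sorries).  Zero `instance`,
zero `notation`, no attribute changes, no `native_decide` in this file; no `def … : Prop`; every conjecture / print fact appears only as an explicit
hypothesis (`Buthe2016_thm2`, `Buthe2018_thm2_theta`, `BroadbentEtAl2021_theta_rel_1e19`, `RiemannHypothesisUpTo T`).

THE LINE.  A colossally abundant `N = ∏ p^{a_p}` with largest prime `P` and structure prime `Q` (largest prime of exponent `≥ 2`) satisfies not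
only `log N ≥ θ(P) + θ(Q)` (the tree) but `log N ≥ θ(P) + θ(Q) + Λ` with `Λ = Σ_{j≥3} θ(x_j)` the higher storeys of the Alaoglu–Erdős staircase;
`Λ_K` is certified per dyadic piece `2^K ≤ P < 2^{K+1}` and spent on the analytic side as EXTRA zero-tail budget `d_k` on top of the tree's level
budgets `b_k` (`E_b` is affine in `b`; the gain `G₁^Λ − G₁` pays `d_k·w(P)`), so the SAME verified height `T` certifies a LONGER range of CA primes.

HONEST LABEL: «SPLITTING SEARCH over kernel-typed RH-EQUIVALENCES; a splitting A ∧ B ⟹ RH is CONDITIONAL bookkeeping unless A and B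
are both proved; nothing here bears on the truth of RH.»
-/

set_option linter.dupNamespace false

noncomputable section

open Real Finset
open scoped ArithmeticFunction.sigma Chebyshev

namespace Summit.RiemannHypothesis.RiemannHypothesis.Theorems.Splittings.RobinFiniteC1

section StaircaseRanges

open Literature.NumberTheory.LFunctions Literature.NumberTheory.DiophantineGeometry
open RobinAnalyticSharp RobinAnalyticSharp.Cells
open Summit.RiemannHypothesis.RiemannHypothesis.Theorems.Splittings.RobinFiniteE3
open Summit.RiemannHypothesis.RiemannHypothesis.Theorems.Splittings.RobinFiniteTail

/-! ### D · rows: the height law of the staircase at verified heights `T ≥ 10⁵`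

`tailH(T) = (log(T/2π) + 1)/(πT) + (184 + 30 log T)/T²` is bounded at each threshold `T₀` by elementary numerics
(`e ≥ 2.7182818283`, `1 + x ≤ eˣ`, `π ≥ 3.141592`) and is antitone on `[10⁵, ∞)`; the full levels then pass by `tolSt`,
the partial top level by `(√X + 1/√X)/2 ≤ (s + 1)/2` for `X ≤ s²`. -/

/-- `2.7182818283ⁿ·(1 + x)¹⁰⁰ ≤ e^{n + 100x}` (`x ≥ 0`). -/
theorem exp_ge_num (n : ℕ) {x : ℝ} (hx : 0 ≤ x) :
    (2.7182818283 : ℝ) ^ n * (1 + x) ^ 100 ≤ Real.exp (n + 100 * x) := by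
  have he := Real.exp_one_gt_d9
  have h2 : (2.7182818283 : ℝ) ^ n ≤ Real.exp 1 ^ n := pow_le_pow_left₀ (by norm_num) he.le n
  have h3 : (1 + x) ^ 100 ≤ Real.exp x ^ 100 :=
    pow_le_pow_left₀ (by linarith) (by linarith [Real.add_one_le_exp x]) 100
  have h1 : Real.exp 1 ^ n * Real.exp x ^ 100 = Real.exp (n + 100 * x) := by
    rw [← Real.exp_nat_mul, ← Real.exp_nat_mul, ← Real.exp_add]
    congr 1; push_cast; ring
  calc (2.7182818283 : ℝ) ^ n * (1 + x) ^ 100 ≤ Real.exp 1 ^ n * Real.exp x ^ 100 :=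
        mul_le_mul h2 h3 (by positivity) (by positivity)
    _ = Real.exp (n + 100 * x) := h1

/-- `log T₀ ≤ n + 100x` from `T₀ ≤ 2.7182818283ⁿ(1+x)¹⁰⁰`. -/
theorem log_le_num {T₀ : ℝ} (hT : 0 < T₀) (n : ℕ) {x : ℝ} (hx : 0 ≤ x)
    (h : T₀ ≤ (2.7182818283 : ℝ) ^ n * (1 + x) ^ 100) : Real.log T₀ ≤ n + 100 * x := by
  rw [Real.log_le_iff_le_exp hT]; exact h.trans (exp_ge_num n hx)

/-- `log(T₀/2π) ≤ n + 100x` from `T₀ ≤ 6.283184·2.7182818283ⁿ(1+x)¹⁰⁰`. -/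
theorem log_div_two_pi_le_num {T₀ : ℝ} (hT : 0 < T₀) (n : ℕ) {x : ℝ} (hx : 0 ≤ x)
    (h : T₀ ≤ 6.283184 * ((2.7182818283 : ℝ) ^ n * (1 + x) ^ 100)) :
    Real.log (T₀ / (2 * π)) ≤ n + 100 * x := by
  have hπ := Real.pi_gt_d6
  rw [Real.log_le_iff_le_exp (by positivity), div_le_iff₀ (by positivity)]
  calc T₀ ≤ 6.283184 * ((2.7182818283 : ℝ) ^ n * (1 + x) ^ 100) := h
    _ ≤ (2 * π) * Real.exp (n + 100 * x) :=
        mul_le_mul (by linarith) (exp_ge_num n hx) (by positivity) (by positivity)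
    _ = Real.exp (n + 100 * x) * (2 * π) := mul_comm _ _

/-- `tailH(T₀)` by numerals. -/
theorem tailH_le_num {T₀ a b : ℝ} (hT : 1 ≤ T₀) (ha : Real.log (T₀ / (2 * π)) ≤ a) (hb : Real.log T₀ ≤ b)
    (ha0 : 0 ≤ a + 1) :
    (Real.log (T₀ / (2 * π)) + 1) / (π * T₀) + (184 + 30 * Real.log T₀) / T₀ ^ 2 ≤
      (a + 1) / (3.141592 * T₀) + (184 + 30 * b) / T₀ ^ 2 := by
  have hπ := Real.pi_gt_d6
  have h1 : (Real.log (T₀ / (2 * π)) + 1) / (π * T₀) ≤ (a + 1) / (3.141592 * T₀) :=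
    div_le_div₀ ha0 (by linarith) (by positivity) (by nlinarith)
  have h2 : (184 + 30 * Real.log T₀) / T₀ ^ 2 ≤ (184 + 30 * b) / T₀ ^ 2 :=
    div_le_div_of_nonneg_right (by linarith) (by positivity)
  linarith

/-- **`tailH` is antitone on `[10⁵, ∞)`** (so a row at threshold `T₀` holds for every verified height `T ≥ T₀`). -/
theorem tailH_anti {T₀ T : ℝ} (hT₀ : 100000 ≤ T₀) (hT : T₀ ≤ T) :
    (Real.log (T / (2 * π)) + 1) / (π * T) + (184 + 30 * Real.log T) / T ^ 2 ≤
      (Real.log (T₀ / (2 * π)) + 1) / (π * T₀) + (184 + 30 * Real.log T₀) / T₀ ^ 2 := by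
  have hπ := Real.pi_gt_d6
  have hT₀0 : 0 < T₀ := by linarith
  have hT0 : 0 < T := by linarith
  have h9 := nine_le_log_div_two_pi hT₀
  have hL0 : 0 ≤ Real.log T₀ := Real.log_nonneg (by linarith)
  obtain ⟨D, hD, rfl⟩ : ∃ D : ℝ, 0 ≤ D ∧ T = T₀ + D := ⟨T - T₀, by linarith, by ring⟩
  have hq : Real.log ((T₀ + D) / T₀) ≤ (T₀ + D) / T₀ - 1 := Real.log_le_sub_one_of_pos (by positivity)
  have hq' : (T₀ + D) / T₀ - 1 = D / T₀ := by field_simp; ring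
  rw [hq'] at hq
  have hlT : Real.log (T₀ + D) ≤ Real.log T₀ + D / T₀ := by
    have := Real.log_div hT0.ne' hT₀0.ne'; linarith
  have hlr : Real.log ((T₀ + D) / (2 * π)) ≤ Real.log (T₀ / (2 * π)) + D / T₀ := by
    have e : (T₀ + D) / (2 * π) / (T₀ / (2 * π)) = (T₀ + D) / T₀ := by field_simp
    have := Real.log_div (x := (T₀ + D) / (2 * π)) (y := T₀ / (2 * π)) (by positivity) (by positivity)
    rw [e] at this; linarith
  -- first term
  have hDT : D / T₀ * T₀ = D := by field_simp
  have i1 : (Real.log ((T₀ + D) / (2 * π)) + 1) / (π * (T₀ + D)) ≤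
      (Real.log (T₀ / (2 * π)) + 1) / (π * T₀) := by
    rw [div_le_div_iff₀ (by positivity) (by positivity)]
    have j1 := mul_le_mul_of_nonneg_right hlr (show 0 ≤ π * T₀ by positivity)
    have j2 : (Real.log (T₀ / (2 * π)) + D / T₀) * (π * T₀) = Real.log (T₀ / (2 * π)) * (π * T₀) + π * D := by
      have : D / T₀ * (π * T₀) = π * D := by field_simp
      rw [add_mul, this]
    have j3 : 0 ≤ (Real.log (T₀ / (2 * π))) * (π * D) := mul_nonneg (by linarith) (by positivity)
    nlinarith [j1, j2, j3]
  -- second term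
  have i2 : (184 + 30 * Real.log (T₀ + D)) / (T₀ + D) ^ 2 ≤ (184 + 30 * Real.log T₀) / T₀ ^ 2 := by
    rw [div_le_div_iff₀ (by positivity) (by positivity)]
    have j1 : Real.log (T₀ + D) * T₀ ≤ Real.log T₀ * T₀ + D := by
      have := mul_le_mul_of_nonneg_right hlT hT₀0.le
      rw [add_mul, hDT] at this; exact this
    have j2 := mul_le_mul_of_nonneg_right j1 (show 0 ≤ 30 * T₀ by positivity)
    have j3 : 0 ≤ Real.log T₀ * (2 * T₀ * D + D ^ 2) := mul_nonneg hL0 (by positivity)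
    have j4 : 0 ≤ T₀ * D := by positivity
    nlinarith [j2, j3, j4, sq_nonneg D]
  linarith

/-- `(√X + 1/√X)/2 ≤ (s + 1)/2` for `1 ≤ X ≤ s²`. -/
theorem charge_le {X s : ℝ} (h1 : 1 ≤ X) (hs : X ≤ s ^ 2) (hs0 : 0 ≤ s) : (√X + (√X)⁻¹) / 2 ≤ (s + 1) / 2 := by
  have h2 : √X ≤ s := by rw [← Real.sqrt_sq hs0]; exact Real.sqrt_le_sqrt hs
  have h3 : 1 ≤ √X := by rw [← Real.sqrt_one]; exact Real.sqrt_le_sqrt h1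
  have h4 : (√X)⁻¹ ≤ 1 := inv_le_one_of_one_le₀ h3
  linarith

/-- The partial-top-level condition by numerals. -/
theorem top_of_num {t τ X s c B : ℝ} (ht0 : 0 ≤ t) (ht : t ≤ τ) (hX1 : 1 ≤ X) (hs : X ≤ s ^ 2) (hs0 : 0 ≤ s)
    (hc : 0 ≤ c) (hnum : 0.0463 + (1 + c) * (τ * ((s + 1) / 2)) ≤ B) :
    0.0463 + (1 + c) * (t * ((√X + (√X)⁻¹) / 2)) ≤ B := by
  have hch := charge_le hX1 hs hs0
  have hch0 : 0 ≤ (√X + (√X)⁻¹) / 2 := by positivity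
  have h1 : t * ((√X + (√X)⁻¹) / 2) ≤ τ * ((s + 1) / 2) := mul_le_mul ht hch hch0 (ht0.trans ht)
  have h2 := mul_le_mul_of_nonneg_left h1 (show 0 ≤ 1 + c by linarith)
  linarith

/-- **ROW A · `RH(T)`, any `T ≥ 100 000`, + the three prints ⟹ Robin at every CA `N > 5040` with all primes `< ``250 000 001`
(`X = 250 000 000`; tree at `T = 10⁵`: no dyadic level passes the un-shifted budgets (`tailH(10⁵) = 3.42·10⁻⁵ > tolR 11 = 2.533·10⁻⁵`); primes `< 4¹¹` only). -/
theorem robinCA_below_stair_100000 (h16 : Buthe2016_thm2) (hB : Buthe2018_thm2_theta)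
    (hK : BroadbentEtAl2021_theta_rel_1e19) {T : ℝ} (hT : 100000 ≤ T) (hRH : RiemannHypothesisUpTo T) :
    robinCA_below 250000001 := by
  have hT5 : (100000 : ℝ) ≤ T := le_trans (by norm_num) hT
  have ht0 := tailH_nonneg (show (7 : ℝ) ≤ T by linarith)
  have ht := (tailH_anti (by norm_num) hT).trans tailH_1e5_le
  show robinCA_below (250000000 + 1)
  refine robinCA_below_stair h16 hB hK hT5 hRH (X := 250000000) (by norm_num) (fun k hk11 hk17 hfl => ?_)
    (fun k hk11 hk17 hkl hku => ?_)
  · interval_cases k <;> first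
      | (exfalso; norm_num at hfl; done)
      | (refine ht.trans ?_; simp only [tolSt]; push_cast; norm_num)
  · interval_cases k <;> first
      | (exfalso; norm_num at hkl hku; done)
      | exact top_of_num ht0 ht (by norm_num) (s := 15812) (by norm_num) (by norm_num)
          (by simp only [L1, l2]; push_cast; norm_num) (by simp only [L1, l2, bk, dk]; push_cast; norm_num)

/-- `tailH(105000) ≤ 3.25765e-5`. -/
theorem tailH_105000_le :
    (Real.log (105000 / (2 * π)) + 1) / (π * 105000) + (184 + 30 * Real.log 105000) / 105000 ^ 2 ≤ 3.25765e-5 := by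
  have ha := log_div_two_pi_le_num (T₀ := 105000) (by norm_num) 9 (x := 0.0073) (by norm_num) (by norm_num)
  have hb := log_le_num (T₀ := 105000) (by norm_num) 11 (x := 0.0057) (by norm_num) (by norm_num)
  refine (tailH_le_num (T₀ := 105000) (by norm_num) ha hb (by norm_num)).trans ?_
  norm_num

/-- **ROW B · `RH(T)`, any `T ≥ 105 000`, + the three prints ⟹ Robin at every CA `N > 5040` with all primes `< ``4^14`
(`X = 4^14 − 1`; tree: `4¹⁴` needs `T ≥ 1.6·10⁵` (`robinCA_below_of_rh160000_refl`)). -/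
theorem robinCA_below_stair_105000 (h16 : Buthe2016_thm2) (hB : Buthe2018_thm2_theta)
    (hK : BroadbentEtAl2021_theta_rel_1e19) {T : ℝ} (hT : 105000 ≤ T) (hRH : RiemannHypothesisUpTo T) :
    robinCA_below 268435456 := by
  have hT5 : (100000 : ℝ) ≤ T := le_trans (by norm_num) hT
  have ht0 := tailH_nonneg (show (7 : ℝ) ≤ T by linarith)
  have ht := (tailH_anti (by norm_num) hT).trans tailH_105000_le
  show robinCA_below (268435455 + 1)
  refine robinCA_below_stair h16 hB hK hT5 hRH (X := 268435455) (by norm_num) (fun k hk11 hk17 hfl => ?_)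
    (fun k hk11 hk17 hkl hku => ?_)
  · interval_cases k <;> first
      | (exfalso; norm_num at hfl; done)
      | (refine ht.trans ?_; simp only [tolSt]; push_cast; norm_num)
  · interval_cases k <;> first
      | (exfalso; norm_num at hkl hku; done)
      | exact top_of_num ht0 ht (by norm_num) (s := 16384) (by norm_num) (by norm_num)
          (by simp only [L1, l2]; push_cast; norm_num) (by simp only [L1, l2, bk, dk]; push_cast; norm_num)

/-- `tailH(160000) ≤ 2.22035e-5`. -/
theorem tailH_160000_le :
    (Real.log (160000 / (2 * π)) + 1) / (π * 160000) + (184 + 30 * Real.log 160000) / 160000 ^ 2 ≤ 2.22035e-5 := by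
  have ha := log_div_two_pi_le_num (T₀ := 160000) (by norm_num) 10 (x := 0.0015) (by norm_num) (by norm_num)
  have hb := log_le_num (T₀ := 160000) (by norm_num) 12 (x := 0) (by norm_num) (by norm_num)
  refine (tailH_le_num (T₀ := 160000) (by norm_num) ha hb (by norm_num)).trans ?_
  norm_num

/-- **ROW C · `RH(T)`, any `T ≥ 160 000`, + the three prints ⟹ Robin at every CA `N > 5040` with all primes `< ``850 000 001`
(`X = 850 000 000`; tree at `T ≥ 1.6·10⁵`: `4¹⁴ ≈ 2.7·10⁸`). -/
theorem robinCA_below_stair_160000 (h16 : Buthe2016_thm2) (hB : Buthe2018_thm2_theta)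
    (hK : BroadbentEtAl2021_theta_rel_1e19) {T : ℝ} (hT : 160000 ≤ T) (hRH : RiemannHypothesisUpTo T) :
    robinCA_below 850000001 := by
  have hT5 : (100000 : ℝ) ≤ T := le_trans (by norm_num) hT
  have ht0 := tailH_nonneg (show (7 : ℝ) ≤ T by linarith)
  have ht := (tailH_anti (by norm_num) hT).trans tailH_160000_le
  show robinCA_below (850000000 + 1)
  refine robinCA_below_stair h16 hB hK hT5 hRH (X := 850000000) (by norm_num) (fun k hk11 hk17 hfl => ?_)
    (fun k hk11 hk17 hkl hku => ?_)
  · interval_cases k <;> first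
      | (exfalso; norm_num at hfl; done)
      | (refine ht.trans ?_; simp only [tolSt]; push_cast; norm_num)
  · interval_cases k <;> first
      | (exfalso; norm_num at hkl hku; done)
      | exact top_of_num ht0 ht (by norm_num) (s := 29155) (by norm_num) (by norm_num)
          (by simp only [L1, l2]; push_cast; norm_num) (by simp only [L1, l2, bk, dk]; push_cast; norm_num)

/-- `tailH(180000) ≤ 1.99467e-5`. -/
theorem tailH_180000_le :
    (Real.log (180000 / (2 * π)) + 1) / (π * 180000) + (184 + 30 * Real.log 180000) / 180000 ^ 2 ≤ 1.99467e-5 := by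
  have ha := log_div_two_pi_le_num (T₀ := 180000) (by norm_num) 10 (x := 0.0027) (by norm_num) (by norm_num)
  have hb := log_le_num (T₀ := 180000) (by norm_num) 12 (x := 0.0011) (by norm_num) (by norm_num)
  refine (tailH_le_num (T₀ := 180000) (by norm_num) ha hb (by norm_num)).trans ?_
  norm_num

/-- **ROW D · `RH(T)`, any `T ≥ 180 000`, + the three prints ⟹ Robin at every CA `N > 5040` with all primes `< ``4^15`
(`X = 4^15 − 1`; tree: `4¹⁵` needs `T ≥ 3.3·10⁵` (`robinCA_below_of_rh330000_refl`)). -/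
theorem robinCA_below_stair_180000 (h16 : Buthe2016_thm2) (hB : Buthe2018_thm2_theta)
    (hK : BroadbentEtAl2021_theta_rel_1e19) {T : ℝ} (hT : 180000 ≤ T) (hRH : RiemannHypothesisUpTo T) :
    robinCA_below 1073741824 := by
  have hT5 : (100000 : ℝ) ≤ T := le_trans (by norm_num) hT
  have ht0 := tailH_nonneg (show (7 : ℝ) ≤ T by linarith)
  have ht := (tailH_anti (by norm_num) hT).trans tailH_180000_le
  show robinCA_below (1073741823 + 1)
  refine robinCA_below_stair h16 hB hK hT5 hRH (X := 1073741823) (by norm_num) (fun k hk11 hk17 hfl => ?_)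
    (fun k hk11 hk17 hkl hku => ?_)
  · interval_cases k <;> first
      | (exfalso; norm_num at hfl; done)
      | (refine ht.trans ?_; simp only [tolSt]; push_cast; norm_num)
  · interval_cases k <;> first
      | (exfalso; norm_num at hkl hku; done)
      | exact top_of_num ht0 ht (by norm_num) (s := 32768) (by norm_num) (by norm_num)
          (by simp only [L1, l2]; push_cast; norm_num) (by simp only [L1, l2, bk, dk]; push_cast; norm_num)

/-- `tailH(330000) ≤ 1.14644e-5`. -/
theorem tailH_330000_le :
    (Real.log (330000 / (2 * π)) + 1) / (π * 330000) + (184 + 30 * Real.log 330000) / 330000 ^ 2 ≤ 1.14644e-5 := by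
  have ha := log_div_two_pi_le_num (T₀ := 330000) (by norm_num) 10 (x := 0.0088) (by norm_num) (by norm_num)
  have hb := log_le_num (T₀ := 330000) (by norm_num) 12 (x := 0.0071) (by norm_num) (by norm_num)
  refine (tailH_le_num (T₀ := 330000) (by norm_num) ha hb (by norm_num)).trans ?_
  norm_num

/-- **ROW E · `RH(T)`, any `T ≥ 330 000`, + the three prints ⟹ Robin at every CA `N > 5040` with all primes `< ``4 000 000 001`
(`X = 4 000 000 000`; tree at `T ≥ 3.3·10⁵`: `4¹⁵ ≈ 1.07·10⁹`). -/
theorem robinCA_below_stair_330000 (h16 : Buthe2016_thm2) (hB : Buthe2018_thm2_theta)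
    (hK : BroadbentEtAl2021_theta_rel_1e19) {T : ℝ} (hT : 330000 ≤ T) (hRH : RiemannHypothesisUpTo T) :
    robinCA_below 4000000001 := by
  have hT5 : (100000 : ℝ) ≤ T := le_trans (by norm_num) hT
  have ht0 := tailH_nonneg (show (7 : ℝ) ≤ T by linarith)
  have ht := (tailH_anti (by norm_num) hT).trans tailH_330000_le
  show robinCA_below (4000000000 + 1)
  refine robinCA_below_stair h16 hB hK hT5 hRH (X := 4000000000) (by norm_num) (fun k hk11 hk17 hfl => ?_)
    (fun k hk11 hk17 hkl hku => ?_)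
  · interval_cases k <;> first
      | (exfalso; norm_num at hfl; done)
      | (refine ht.trans ?_; simp only [tolSt]; push_cast; norm_num)
  · interval_cases k <;> first
      | (exfalso; norm_num at hkl hku; done)
      | exact top_of_num ht0 ht (by norm_num) (s := 63246) (by norm_num) (by norm_num)
          (by simp only [L1, l2]; push_cast; norm_num) (by simp only [L1, l2, bk, dk]; push_cast; norm_num)

/-- `tailH(340000) ≤ 1.11552e-5`. -/
theorem tailH_340000_le :
    (Real.log (340000 / (2 * π)) + 1) / (π * 340000) + (184 + 30 * Real.log 340000) / 340000 ^ 2 ≤ 1.11552e-5 := by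
  have ha := log_div_two_pi_le_num (T₀ := 340000) (by norm_num) 10 (x := 0.0091) (by norm_num) (by norm_num)
  have hb := log_le_num (T₀ := 340000) (by norm_num) 12 (x := 0.0074) (by norm_num) (by norm_num)
  refine (tailH_le_num (T₀ := 340000) (by norm_num) ha hb (by norm_num)).trans ?_
  norm_num

/-- **ROW E2 · `RH(T)`, any `T ≥ 340 000`, + the three prints ⟹ Robin at every CA `N > 5040` with all primes `< ``4^16`
(`X = 4^16 − 1`; tree: `4¹⁶` needs `T ≥ 5·10⁵` (`robinCA_below_of_rh500000_refl`)). -/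
theorem robinCA_below_stair_340000 (h16 : Buthe2016_thm2) (hB : Buthe2018_thm2_theta)
    (hK : BroadbentEtAl2021_theta_rel_1e19) {T : ℝ} (hT : 340000 ≤ T) (hRH : RiemannHypothesisUpTo T) :
    robinCA_below 4294967296 := by
  have hT5 : (100000 : ℝ) ≤ T := le_trans (by norm_num) hT
  have ht0 := tailH_nonneg (show (7 : ℝ) ≤ T by linarith)
  have ht := (tailH_anti (by norm_num) hT).trans tailH_340000_le
  show robinCA_below (4294967295 + 1)
  refine robinCA_below_stair h16 hB hK hT5 hRH (X := 4294967295) (by norm_num) (fun k hk11 hk17 hfl => ?_)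
    (fun k hk11 hk17 hkl hku => ?_)
  · interval_cases k <;> first
      | (exfalso; norm_num at hfl; done)
      | (refine ht.trans ?_; simp only [tolSt]; push_cast; norm_num)
  · interval_cases k <;> first
      | (exfalso; norm_num at hkl hku; done)
      | exact top_of_num ht0 ht (by norm_num) (s := 65536) (by norm_num) (by norm_num)
          (by simp only [L1, l2]; push_cast; norm_num) (by simp only [L1, l2, bk, dk]; push_cast; norm_num)

end StaircaseRanges

end Summit.RiemannHypothesis.RiemannHypothesis.Theorems.Splittings.RobinFiniteC1

end
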